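import Summits.QuantumFields.YangMills.Theorems.FluctuationComparisonRegPrIntLS2BetaFlatInteriorCoOptimised
import Literature.MathematicalPhysics.QuantumFieldTheory.Balaban1983to89.B15Prop1Carrier
import HarnessLib

/-!
# SUP-CONDITIONING LETTERS OF THE EXPOSED BOX GAUGES: the `ℓ^∞` companion of (6)∕(10)∕(11)
# (crux `FluctuationComparisonRegPrIntL`, stmt-QuantumFields-20520; registry v11.4 `Cruxes/FluctuationComparisonRegPrIntL/Lines/semiclassical_s2beta.lean` 3732b7df FROZEN, untouched)

Cell `ym3-torus` (YM ladder rung R3 = continuum `SU(2)` Yang–Mills on the three-torus — a RUNG: NOT d = 4, NOT infinite volume, NOT a mass gap, NOT Clay).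
Width seat `ym3-torus-px10` (gen 21); `--kind proof --supports stmt-QuantumFields-20520 --as helper`, count-neutral, DEFINITION-FREE (0 `def`, 0 `instance`,
0 `notation`, 0 `sorry`, default heartbeats).

WHY.  The road to the depth-uniform flat letter `hFlat` of ✓`…S2BetaGapOrbitOfStrata.uniformFibreGapOrbit_of_strata_of_flat` (px12 g22's note
`HFLAT-ROAD-AFTER-6` §3–§5) fixes the gauge by px19 g9's ROOTED AXIAL BOX GAUGES on the `m`-blocks, glued and normalised at the block centres
(✓(6) `…S2BetaFlatInteriorDepthUniform`, ✓(10) `…S2BetaBoxGaugeCoOptimisedRoot`, ✓(11) `…S2BetaFlatInteriorCoOptimised.exists_rooted_sum_intraBlock_sq_le_and`,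
which EXPOSES the gauges `g y` and the glued `w`).  Those files are `ℓ²` statements.  The NONLINEAR steps of the road — spreading the through-face transporters
along the lines by `n`-th roots (✓(8) `…S2BetaDistributedHolonomySU2`, ✓(9) `…S2BetaLineBundleSpreading`) — need SUP control: ✓(9)'s
`sum_sum_sq_chain_transversal_le` carries the entry condition `hXd : ∀ x, dist1 (Xd x) ≤ √2` (every line's datum inside the hemisphere about the common
representative), and the note's obstacle (α) reads «an axial box gauge gives sup intra `≤ n·θBal(K)`».  This file types that sentence and its first
consequences, for the SAME exposed gauges, so that the consumer obtains the `ℓ²` and the `ℓ^∞` control from ONE `obtain`.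

WHAT (all `[GaugeGroup G]`, any member `F.P K` of a `T3Family`, `d = 3`).
* §0 group algebra: from a lattice square `P = A·B·C⁻¹·D⁻¹` the two parallel sides satisfy `dist1(A·C⁻¹) ≤ dist1 P + dist1 B + dist1 D` and
  `dist1(D·B⁻¹) ≤ dist1 P + dist1 A + dist1 C`; the bridge `dist1(U ℓ·((w • 1) ℓ)⁻¹) = dist1((w⁻¹ • U) ℓ)` between (6)∕(11)'s functional and the
  gauge-fixed field `w⁻¹ • U` (gauge covariance of `dist1 (U(∂p))` is lit ✓`B15Prop1Carrier.dist1_plaqHol_gaugeAct`).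
* §1 ★ MEMBER FORM `dist1_gaugeAct_le_of_root`: in the axial gauge rooted at `corner + r·e₀` (ANY root `r ≤ n − 1` — in particular (10)∕(11)'s co-optimised
  one) every bond with both ends in the side-`n` box has `dist1((g • U)_b) ≤ 2(n−1)·θ` as soon as the box plaquettes are `θ`-small: direction `0` is a
  tree bond (`= 1`), direction `1` is one `(0,1)`-ladder of `≤ n−1` plaquettes, direction `2` is the spine-plane `(1,2)`-ladder plus one `(0,2)`-ladder
  (px19 g9's `ℓ¹` rows ✓`CurvaturePoincareBoxBonds.gaugeAct_zero_eq_one ∕ dist1_gaugeAct_one_le ∕ dist1_gaugeAct_two_le`, summed against the sup).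
* §2 ★★ GLUED FORM `dist1_intra_le`: for roots `r`, gauges `g`, glued `w` IN THE SHAPE (11) RETURNS THEM (its conjuncts taken as hypotheses, so the
  consumer docks by `exact`), every intra-block comparison obeys `dist1(U ℓ·((w • 1) ℓ)⁻¹) ≤ 2(L^m − 1)·θ` under `∀ p, dist1(U(∂p)) ≤ θ`
  (the centre constant conjugates away).
* §3 ★★ FACE NEIGHBOURS `dist1_cross_mul_inv_cross_le_mu ∕ _ν`: for the two parallel bonds of ONE plaquette whose other two bonds are intra-block, the
  gauge-fixed variables `X_ℓ := (w⁻¹ • U) ℓ` (the through-face transporters centre → centre when `ℓ` crosses a face) satisfy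
  `dist1(X_ℓ·X_{ℓ′}⁻¹) ≤ θ + 2·(2(L^m − 1)·θ) = (4(L^m−1) + 1)·θ` — the note's «`dist1(X_x X_{x′}⁻¹) ≤ 2·(sup intra) + θBal(K)`» as a kernel fact.

GENERALITY.  §1 is stated for a box of ANY side `n` (so in particular `n = L`, one averaging step), §2–§3 for the `m`-blocks of ANY depth `m` (so `m = 1`
gives the one-level letters that a TOP-DOWN iterated residual axial gauge eats level by level — px8 g21 UV3-NODE §57.7, px12 g22 note v4 §7).

LOCATED REMARK (12d) (not a theorem of this file; accepted by px12 g22 06:31Z as a correction of note §4 (α)).  Summing §3 along a path in the face gives,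
for two crossing bonds at transverse distance `d` in the face, `dist1(X_ℓ·X_{ℓ′}⁻¹) ≤ d·(4(L^m−1)+1)·θ`, i.e. up to `≍ (L^m)²·θ` across a whole face —
and this order is ATTAINED in the ONE-SHOT finest-level box gauge by `θ`-small fields of coherent curvature (the two transporters differ by an `L^m × d`
Wilson loop; the two spine-plane loops need not cancel).  So ✓(9)'s ONE-ball hypothesis over a whole face is supplied by the level-`K` threshold alone
only while `(L^m)²·θBal(K) ≲ 1` («m ≲ K∕4»); the note's «m ≲ K∕2» is the NEIGHBOUR condition `L^m·θBal(K) ≲ 1` (§3), which presupposes representatives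
varying across the face.  On the TELESCOPED road (gauge first, top-down, side `L` per level) the remark is moot: every interpolated object is level-sized.

HONEST: lattice bookkeeping over landed rows; nothing of Bałaban's analysis; `hFlat`, TUBE-REG∘, GAP♯∘, EXW∘, S2β, crux 20520 NOT proved; no registered stub is
closed; rung R3 = SU(2) YM₃ on T³ — NOT d = 4, NOT infinite volume, NOT a mass gap, NOT Clay; the Yang–Mills mass gap is NOT proved.  Sorry-free, axioms standard.

References: M. Creutz, «Quarks, gluons and lattices» (1983) ch. 9 [folklore] (axial gauge); K. Uhlenbeck, CMP **83** (1982) 31–42 [Uhlenbeck1982];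
T. Bałaban, CMP **99** (1985) 75–102 [Balaban1985RegularSpaces] (Lemma 1 (1.25) p.79, the regular-space sup conditions (1.29) p.81); CMP **96** (1984)
223–250 [Balaban1984PropagatorsII] ((1.33)); CMP **109** (1987) 249–301 [Balaban1987RG1] ((0.1)–(0.3) p.252, (0.18) p.255).
-/

set_option autoImplicit false

namespace Summit.QuantumFields.YangMills.Theorems.FluctuationComparisonRegPrIntLS2BetaBoxGaugeSupLetters

open Finset
open Literature.MathematicalPhysics.QuantumFieldTheory.Balaban1983to89
open T4Continuum
open T3ContinuumYM3Torus
open T4AxialGaugeSmallField (boxPlaqs castSite castSite_apply pull hol_pull_plaqWord_of_lt)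
open B7Prop1Explicit (e e_apply hol plaqWord axialFn)
open B5Eq118OneStroke (iterBlockOf val_iterBlockOf)
open B15DeterminingSets (embIter)
open Summit.QuantumFields.YangMills.Theorems.CurvaturePoincareBoxBonds
  (le_ptP ptP_add_e_zero_add_e_one_le ptP_add_e_one_add_e_two_le ptP_add_e_zero_add_e_two_le bond_coords
    gaugeAct_zero_eq_one dist1_gaugeAct_one_le dist1_gaugeAct_two_le)
open Summit.QuantumFields.YangMills.Theorems.FluctuationComparisonRegPrIntLS2BetaFlatInteriorDepthUniform (box_of_iterBlockOf)

/-! ## §0 Group algebra: parallel sides of a square; the bridge to the gauge-fixed field; gauge covariance -/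

section Algebra

variable {G : Type*} [GaugeGroup G]

/-- **Parallel sides of a square, first pair**: if `P = A·B·C⁻¹·D⁻¹` then `A·C⁻¹ = P·D·(C·B⁻¹·C⁻¹)`, so `dist1(A·C⁻¹) ≤ dist1 P + dist1 B + dist1 D`
(subadditivity, conjugation and inversion invariance of `dist1`). [folklore] -/
theorem dist1_mul_inv_le_of_square (A B C D : G) :
    dist1 (A * C⁻¹) ≤ dist1 (A * B * C⁻¹ * D⁻¹) + dist1 B + dist1 D := by
  have h : A * C⁻¹ = (A * B * C⁻¹ * D⁻¹) * D * (C * B⁻¹ * C⁻¹) := by group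
  rw [h]
  calc dist1 ((A * B * C⁻¹ * D⁻¹) * D * (C * B⁻¹ * C⁻¹))
      ≤ dist1 ((A * B * C⁻¹ * D⁻¹) * D) + dist1 (C * B⁻¹ * C⁻¹) := GaugeGroup.dist1_mul_le _ _
    _ ≤ dist1 (A * B * C⁻¹ * D⁻¹) + dist1 D + dist1 (C * B⁻¹ * C⁻¹) := by
        have h' := GaugeGroup.dist1_mul_le (A * B * C⁻¹ * D⁻¹) D
        linarith
    _ = dist1 (A * B * C⁻¹ * D⁻¹) + dist1 B + dist1 D := by
        rw [GaugeGroup.dist1_conj, GaugeGroup.dist1_inv]; ring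

/-- **Parallel sides of a square, second pair**: if `P = A·B·C⁻¹·D⁻¹` then `D·B⁻¹ = P⁻¹·A·(B·C⁻¹·B⁻¹)`, so `dist1(D·B⁻¹) ≤ dist1 P + dist1 A + dist1 C`.
[folklore] -/
theorem dist1_mul_inv_le_of_square' (A B C D : G) :
    dist1 (D * B⁻¹) ≤ dist1 (A * B * C⁻¹ * D⁻¹) + dist1 A + dist1 C := by
  have h : D * B⁻¹ = (A * B * C⁻¹ * D⁻¹)⁻¹ * A * (B * C⁻¹ * B⁻¹) := by group
  rw [h]
  calc dist1 ((A * B * C⁻¹ * D⁻¹)⁻¹ * A * (B * C⁻¹ * B⁻¹))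
      ≤ dist1 ((A * B * C⁻¹ * D⁻¹)⁻¹ * A) + dist1 (B * C⁻¹ * B⁻¹) := GaugeGroup.dist1_mul_le _ _
    _ ≤ dist1 (A * B * C⁻¹ * D⁻¹)⁻¹ + dist1 A + dist1 (B * C⁻¹ * B⁻¹) := by
        have h' := GaugeGroup.dist1_mul_le (A * B * C⁻¹ * D⁻¹)⁻¹ A
        linarith
    _ = dist1 (A * B * C⁻¹ * D⁻¹) + dist1 A + dist1 C := by
        rw [GaugeGroup.dist1_conj, GaugeGroup.dist1_inv, GaugeGroup.dist1_inv]

variable {P : Params} {j : ℕ}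

/-- **THE BRIDGE**: the summand of (6)∕(11)'s orbit functional is the gauge-FIXED bond variable — `dist1(U ℓ·((w • 1) ℓ)⁻¹) = dist1((w⁻¹ • U) ℓ)`
(`(w • 1) ℓ = w(ℓ₋)·w(ℓ₊)⁻¹`, `(w⁻¹ • U) ℓ = w(ℓ₋)⁻¹·U ℓ·w(ℓ₊)`, conjugation by `w(ℓ₋)`). [folklore] -/
theorem dist1_mul_gaugeAct_one_inv (w : Site P j → G) (U : GaugeField P j G) (ℓ : PBond P j) :
    dist1 (U ℓ * ((GaugeField.gaugeAct w 1) ℓ)⁻¹) = dist1 (GaugeField.gaugeAct (fun x => (w x)⁻¹) U ℓ) := by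
  have h : GaugeField.gaugeAct (fun x => (w x)⁻¹) U ℓ = (w ℓ.src)⁻¹ * (U ℓ * ((GaugeField.gaugeAct w 1) ℓ)⁻¹) * ((w ℓ.src)⁻¹)⁻¹ := by
    show (w ℓ.src)⁻¹ * U ℓ * ((w ℓ.tgt)⁻¹)⁻¹ = (w ℓ.src)⁻¹ * (U ℓ * (w ℓ.src * 1 * (w ℓ.tgt)⁻¹)⁻¹) * ((w ℓ.src)⁻¹)⁻¹
    group
  rw [h, GaugeGroup.dist1_conj]

/-- **ONE PLAQUETTE, TWO PARALLEL `μ`-BONDS** (any gauge `u`): `dist1((u•U)(x,μ)·((u•U)(x+e_ν,μ))⁻¹) ≤ dist1(U(∂p)) + dist1((u•U)(x+e_μ,ν)) + dist1((u•U)(x,ν))`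
for `p = ⟨x, μ, ν⟩` — the face-neighbour comparison of two `μ`-transporters costs one plaquette and the two connecting `ν`-bonds. [folklore] -/
theorem dist1_gaugeAct_mul_inv_le_of_plaq_mu (u : GaugeTransf P j G) (U : GaugeField P j G) (p : Plaq P j) :
    dist1 (GaugeField.gaugeAct u U ⟨p.src, p.μ⟩ * (GaugeField.gaugeAct u U ⟨p.src.shift p.ν, p.μ⟩)⁻¹) ≤
      dist1 (GaugeField.plaqHol U p) + dist1 (GaugeField.gaugeAct u U ⟨p.src.shift p.μ, p.ν⟩) +
        dist1 (GaugeField.gaugeAct u U ⟨p.src, p.ν⟩) := by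
  have h := dist1_mul_inv_le_of_square (GaugeField.gaugeAct u U ⟨p.src, p.μ⟩) (GaugeField.gaugeAct u U ⟨p.src.shift p.μ, p.ν⟩)
    (GaugeField.gaugeAct u U ⟨p.src.shift p.ν, p.μ⟩) (GaugeField.gaugeAct u U ⟨p.src, p.ν⟩)
  have hp : GaugeField.gaugeAct u U ⟨p.src, p.μ⟩ * GaugeField.gaugeAct u U ⟨p.src.shift p.μ, p.ν⟩ *
      (GaugeField.gaugeAct u U ⟨p.src.shift p.ν, p.μ⟩)⁻¹ * (GaugeField.gaugeAct u U ⟨p.src, p.ν⟩)⁻¹ =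
      GaugeField.plaqHol (GaugeField.gaugeAct u U) p := rfl
  rw [hp, B15Prop1Carrier.dist1_plaqHol_gaugeAct] at h
  exact h

/-- **ONE PLAQUETTE, TWO PARALLEL `ν`-BONDS** (any gauge `u`): `dist1((u•U)(x,ν)·((u•U)(x+e_μ,ν))⁻¹) ≤ dist1(U(∂p)) + dist1((u•U)(x,μ)) + dist1((u•U)(x+e_ν,μ))`
for `p = ⟨x, μ, ν⟩`. [folklore] -/
theorem dist1_gaugeAct_mul_inv_le_of_plaq_nu (u : GaugeTransf P j G) (U : GaugeField P j G) (p : Plaq P j) :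
    dist1 (GaugeField.gaugeAct u U ⟨p.src, p.ν⟩ * (GaugeField.gaugeAct u U ⟨p.src.shift p.μ, p.ν⟩)⁻¹) ≤
      dist1 (GaugeField.plaqHol U p) + dist1 (GaugeField.gaugeAct u U ⟨p.src, p.μ⟩) +
        dist1 (GaugeField.gaugeAct u U ⟨p.src.shift p.ν, p.μ⟩) := by
  have h := dist1_mul_inv_le_of_square' (GaugeField.gaugeAct u U ⟨p.src, p.μ⟩) (GaugeField.gaugeAct u U ⟨p.src.shift p.μ, p.ν⟩)
    (GaugeField.gaugeAct u U ⟨p.src.shift p.ν, p.μ⟩) (GaugeField.gaugeAct u U ⟨p.src, p.ν⟩)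
  have hp : GaugeField.gaugeAct u U ⟨p.src, p.μ⟩ * GaugeField.gaugeAct u U ⟨p.src.shift p.μ, p.ν⟩ *
      (GaugeField.gaugeAct u U ⟨p.src.shift p.ν, p.μ⟩)⁻¹ * (GaugeField.gaugeAct u U ⟨p.src, p.ν⟩)⁻¹ =
      GaugeField.plaqHol (GaugeField.gaugeAct u U) p := rfl
  rw [hp, B15Prop1Carrier.dist1_plaqHol_gaugeAct] at h
  exact h

/-- A sum of at most `θ`'s over `range N` is at most `N·θ`. [folklore] -/
theorem sum_range_le_mul {N : ℕ} {f : ℕ → ℝ} {θ : ℝ} (h : ∀ t, t < N → f t ≤ θ) :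
    ∑ t ∈ Finset.range N, f t ≤ (N : ℝ) * θ := by
  calc ∑ t ∈ Finset.range N, f t ≤ ∑ _t ∈ Finset.range N, θ :=
        Finset.sum_le_sum fun t ht => h t (Finset.mem_range.1 ht)
    _ = (N : ℝ) * θ := by rw [Finset.sum_const, Finset.card_range, nsmul_eq_mul]

end Algebra

/-! ## §1 Member form: every box bond is `2(n−1)·θ`-small in a rooted axial gauge -/

section Member

variable (F : T3Family) (K : ℕ) {G : Type*} [GaugeGroup G]

/-- ★ **SUP LETTER OF THE ROOTED AXIAL BOX GAUGE.**  Member `F.P K`, box of side `n` at `x₀` (`1 ≤ n`, `2n ≤ sitesPerDir 0`, no wrap-around), `g` equal on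
the box to the axial gauge rooted at `corner + r·e₀` (`r ≤ n − 1`; ✓`CurvaturePoincareBoxBonds.exists_rooted_gauge`), all box plaquettes `θ`-small.  Then
EVERY bond `b` with both ends in the box has `dist1((g • U)_b) ≤ 2(n−1)·θ`: direction `0` is a tree bond (`gaugeAct_zero_eq_one`), direction `1` is
bounded by the `n − 1` plaquettes of its `(0,1)`-ladder (`dist1_gaugeAct_one_le`), direction `2` by the `(1,2)`-ladder of the spine plane `x₀ = r` plus
its `(0,2)`-ladder (`dist1_gaugeAct_two_le`), each ladder plaquette being a box plaquette (`hol_pull_plaqWord_of_lt` + the corner rows).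
[cite: Balaban1985RegularSpaces, (1.29) p.81] -/
theorem dist1_gaugeAct_le_of_root (U : GaugeField (F.P K) 0 G) {n : ℕ} (hn : 1 ≤ n) (h2n : 2 * n ≤ (F.P K).sitesPerDir 0)
    (x₀ : Site (F.P K) 0) {r : ℕ} (hr : r ≤ n - 1) (g : GaugeTransf (F.P K) 0 G)
    (hg : ∀ x, (fun k => ((x₀ k).val : ℤ)) ≤ x → x ≤ (fun k => ((x₀ k).val : ℤ) + ((n - 1 : ℕ) : ℤ)) →
      g (castSite x) = axialFn (pull U) ((fun k => ((x₀ k).val : ℤ)) + (r : ℤ) • e 0) x)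
    {θ : ℝ} (hθ : ∀ p : Plaq (F.P K) 0, p ∈ boxPlaqs (P := F.P K) (j := 0) (fun k => ((x₀ k).val : ℤ))
      (fun k => ((x₀ k).val : ℤ) + ((n - 1 : ℕ) : ℤ)) → dist1 (GaugeField.plaqHol U p) ≤ θ)
    (b : PBond (F.P K) 0) (hs : ∀ k, (b.src k - x₀ k).val < n) (ht : ∀ k, (b.tgt k - x₀ k).val < n) :
    dist1 (GaugeField.gaugeAct g U b) ≤ 2 * ((n - 1 : ℕ) : ℝ) * θ := by
  classical
  set lo : Fin (F.P K).d → ℤ := fun k => ((x₀ k).val : ℤ) with hlo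
  set N := n - 1 with hN
  obtain ⟨hv, hvd, hsrc⟩ := bond_coords F K hn h2n x₀ b hs ht
  have hN1 : 1 ≤ N := le_trans (by omega) hvd
  have h01 : (0 : Fin (F.P K).d) < 1 := show (0 : Fin 3) < 1 by decide
  have h02 : (0 : Fin (F.P K).d) < 2 := show (0 : Fin 3) < 2 by decide
  have h12 : (1 : Fin (F.P K).d) < 2 := show (1 : Fin 3) < 2 by decide
  -- the three kinds of ladder plaquettes are box plaquettes, hence `θ`-small
  have h01θ : ∀ (t a c : ℕ), t + 1 ≤ N → a + 1 ≤ N → c ≤ N →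
      dist1 (hol (pull U) (lo + (t : ℤ) • e 0 + (a : ℤ) • e 1 + (c : ℤ) • e 2) (plaqWord 0 1)) ≤ θ := by
    intro t a c ht ha hc
    rw [hol_pull_plaqWord_of_lt U _ h01]
    exact hθ _ ⟨_, le_ptP F K lo _ _ _, ptP_add_e_zero_add_e_one_le F K lo ht ha hc, rfl⟩
  have h12θ : ∀ (t a c : ℕ), t ≤ N → a + 1 ≤ N → c + 1 ≤ N →
      dist1 (hol (pull U) (lo + (t : ℤ) • e 0 + (a : ℤ) • e 1 + (c : ℤ) • e 2) (plaqWord 1 2)) ≤ θ := by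
    intro t a c ht ha hc
    rw [hol_pull_plaqWord_of_lt U _ h12]
    exact hθ _ ⟨_, le_ptP F K lo _ _ _, ptP_add_e_one_add_e_two_le F K lo ht ha hc, rfl⟩
  have h02θ : ∀ (t a c : ℕ), t + 1 ≤ N → a ≤ N → c + 1 ≤ N →
      dist1 (hol (pull U) (lo + (t : ℤ) • e 0 + (a : ℤ) • e 1 + (c : ℤ) • e 2) (plaqWord 0 2)) ≤ θ := by
    intro t a c ht ha hc
    rw [hol_pull_plaqWord_of_lt U _ h02]
    exact hθ _ ⟨_, le_ptP F K lo _ _ _, ptP_add_e_zero_add_e_two_le F K lo ht ha hc, rfl⟩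
  -- `θ ≥ 0`: the box has a plaquette (`N ≥ 1`)
  have hθ0 : 0 ≤ θ := (GaugeGroup.dist1_nonneg _).trans (h01θ 0 0 0 (by omega) (by omega) (by omega))
  have hNθ : 0 ≤ (N : ℝ) * θ := mul_nonneg (Nat.cast_nonneg _) hθ0
  -- split by direction (`Fin (F.P K).d` is `Fin 3`)
  have hd : b.dir = 0 ∨ b.dir = 1 ∨ b.dir = 2 := by
    have h : ∀ i : Fin 3, i = 0 ∨ i = 1 ∨ i = 2 := by decide
    exact h b.dir
  rcases hd with hdir | hdir | hdir
  · -- direction 0: a tree bond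
    rw [hdir] at hvd
    have hb_eq : b = ⟨castSite (lo + (((b.src 0 - x₀ 0).val : ℕ) : ℤ) • e 0 + (((b.src 1 - x₀ 1).val : ℕ) : ℤ) • e 1 +
        (((b.src 2 - x₀ 2).val : ℕ) : ℤ) • e 2), 0⟩ := by
      obtain ⟨src, dir⟩ := b
      simp only at hdir hsrc
      subst hdir
      exact congrArg (fun s => (⟨s, 0⟩ : PBond (F.P K) 0)) hsrc
    have h0 := gaugeAct_zero_eq_one F K U lo r g hg hvd (hv 1) (hv 2)
    rw [← hb_eq] at h0
    rw [h0, GaugeGroup.dist1_one]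
    positivity
  · -- direction 1: one `(0,1)`-ladder
    rw [hdir] at hvd
    have hb_eq : b = ⟨castSite (lo + (((b.src 0 - x₀ 0).val : ℕ) : ℤ) • e 0 + (((b.src 1 - x₀ 1).val : ℕ) : ℤ) • e 1 +
        (((b.src 2 - x₀ 2).val : ℕ) : ℤ) • e 2), 1⟩ := by
      obtain ⟨src, dir⟩ := b
      simp only at hdir hsrc
      subst hdir
      exact congrArg (fun s => (⟨s, 1⟩ : PBond (F.P K) 0)) hsrc
    have h1 := dist1_gaugeAct_one_le F K U lo hr g hg (hv 0) hvd (hv 2)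
    rw [← hb_eq] at h1
    refine h1.trans ((sum_range_le_mul (N := N) fun t ht => h01θ t _ _ (by omega) hvd (hv 2)).trans ?_)
    linarith
  · -- direction 2: spine `(1,2)`-ladder + `(0,2)`-ladder
    rw [hdir] at hvd
    have hb_eq : b = ⟨castSite (lo + (((b.src 0 - x₀ 0).val : ℕ) : ℤ) • e 0 + (((b.src 1 - x₀ 1).val : ℕ) : ℤ) • e 1 +
        (((b.src 2 - x₀ 2).val : ℕ) : ℤ) • e 2), 2⟩ := by
      obtain ⟨src, dir⟩ := b
      simp only at hdir hsrc
      subst hdir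
      exact congrArg (fun s => (⟨s, 2⟩ : PBond (F.P K) 0)) hsrc
    have h2 := dist1_gaugeAct_two_le F K U lo hr g hg (hv 0) (hv 1) hvd
    rw [← hb_eq] at h2
    refine h2.trans ?_
    have hA := sum_range_le_mul (N := N) (f := fun s : ℕ => dist1 (hol (pull U) (lo + (r : ℤ) • e 0 + (s : ℤ) • e 1 +
        (((b.src 2 - x₀ 2).val : ℕ) : ℤ) • e 2) (plaqWord 1 2))) fun s hs' => h12θ r s _ hr (by omega) hvd
    have hB := sum_range_le_mul (N := N) (f := fun t : ℕ => dist1 (hol (pull U) (lo + (t : ℤ) • e 0 + (((b.src 1 - x₀ 1).val : ℕ) : ℤ) • e 1 +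
        (((b.src 2 - x₀ 2).val : ℕ) : ℤ) • e 2) (plaqWord 0 2))) fun t ht' => h02θ t _ _ (by omega) (hv 1) hvd
    linarith

/-- The GLOBAL small-field hypothesis implies the box-local one (convenience). [folklore] -/
theorem dist1_gaugeAct_le_of_root_of_forall (U : GaugeField (F.P K) 0 G) {n : ℕ} (hn : 1 ≤ n) (h2n : 2 * n ≤ (F.P K).sitesPerDir 0)
    (x₀ : Site (F.P K) 0) {r : ℕ} (hr : r ≤ n - 1) (g : GaugeTransf (F.P K) 0 G)
    (hg : ∀ x, (fun k => ((x₀ k).val : ℤ)) ≤ x → x ≤ (fun k => ((x₀ k).val : ℤ) + ((n - 1 : ℕ) : ℤ)) →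
      g (castSite x) = axialFn (pull U) ((fun k => ((x₀ k).val : ℤ)) + (r : ℤ) • e 0) x)
    {θ : ℝ} (hθ : ∀ p : Plaq (F.P K) 0, dist1 (GaugeField.plaqHol U p) ≤ θ)
    (b : PBond (F.P K) 0) (hs : ∀ k, (b.src k - x₀ k).val < n) (ht : ∀ k, (b.tgt k - x₀ k).val < n) :
    dist1 (GaugeField.gaugeAct g U b) ≤ 2 * ((n - 1 : ℕ) : ℝ) * θ :=
  dist1_gaugeAct_le_of_root F K U hn h2n x₀ hr g hg (fun p _ => hθ p) b hs ht

end Member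

/-! ## §2 Glued form: the intra-block comparisons of (6)∕(11)'s functional are `2(L^m − 1)·θ`-small -/

section Glued

variable (F : T3Family) {G : Type*} [GaugeGroup G]

/-- ★★ **SUP LETTER OF THE GLUED GAUGE, INTRA-BLOCK BONDS.**  Roots `r y < L^m`, gauges `g y` axial on the box of `y` rooted at `corner(y) + r(y)·e₀`, and the
glued transformation `w x = (g_{B x} x)⁻¹·g_{B x}(centre of B x)` — EXACTLY the conjuncts ✓(11) `exists_rooted_sum_intraBlock_sq_le_and` returns — give, for
every field all of whose plaquettes are `θ`-small and every bond `ℓ` inside one `m`-block, `dist1(U ℓ·((w • 1) ℓ)⁻¹) ≤ 2(L^m − 1)·θ`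
(the value is the conjugate by `g_y(ℓ₋)⁻¹` of the axial bond variable; §1). [cite: Balaban1985RegularSpaces, Lemma 1 (1.25) p.79 and (1.29) p.81] -/
theorem dist1_intra_le (K m : ℕ) (hm : m ≤ F.m + K) (U : GaugeField (F.P K) 0 G)
    (r : Site (F.P K) m → ℕ) (g : Site (F.P K) m → GaugeTransf (F.P K) 0 G) (w : Site (F.P K) 0 → G)
    (hr : ∀ y, r y < F.L ^ m)
    (hga : ∀ y (x : Fin (F.P K).d → ℤ), (fun k => (((((y k).val * (F.P K).L ^ m : ℕ) : ZMod ((F.P K).sitesPerDir 0))).val : ℤ)) ≤ x →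
        x ≤ (fun k => (((((y k).val * (F.P K).L ^ m : ℕ) : ZMod ((F.P K).sitesPerDir 0))).val : ℤ) + ((F.L ^ m - 1 : ℕ) : ℤ)) →
        g y (castSite x) = axialFn (pull U) ((fun k => (((((y k).val * (F.P K).L ^ m : ℕ) : ZMod ((F.P K).sitesPerDir 0))).val : ℤ)) + (r y : ℤ) • e 0) x)
    (hw : ∀ x, w x = (g (iterBlockOf m x) x)⁻¹ * g (iterBlockOf m x) (embIter m (iterBlockOf m x)))
    {θ : ℝ} (hθ : ∀ p : Plaq (F.P K) 0, dist1 (GaugeField.plaqHol U p) ≤ θ)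
    (ℓ : PBond (F.P K) 0) (hℓ : iterBlockOf m ℓ.src = iterBlockOf m ℓ.tgt) :
    dist1 (U ℓ * ((GaugeField.gaugeAct w (1 : GaugeField (F.P K) 0 G)) ℓ)⁻¹) ≤ 2 * ((F.L ^ m - 1 : ℕ) : ℝ) * θ := by
  classical
  have hk : m ≤ (F.P K).m + (F.P K).K := hm
  set y := iterBlockOf m ℓ.src with hy
  have hty : iterBlockOf m ℓ.tgt = y := hℓ.symm
  -- the value on the intra-block bond is the conjugate of the axial bond variable
  have e1 : U ℓ * ((GaugeField.gaugeAct w (1 : GaugeField (F.P K) 0 G)) ℓ)⁻¹ =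
      (g y ℓ.src)⁻¹ * GaugeField.gaugeAct (g y) U ℓ * ((g y ℓ.src)⁻¹)⁻¹ := by
    show U ℓ * (w ℓ.src * 1 * (w ℓ.tgt)⁻¹)⁻¹ = (g y ℓ.src)⁻¹ * (g y ℓ.src * U ℓ * (g y ℓ.tgt)⁻¹) * ((g y ℓ.src)⁻¹)⁻¹
    rw [hw ℓ.src, hw ℓ.tgt, hty, ← hy]
    group
  rw [e1, GaugeGroup.dist1_conj]
  -- §1 on the box of `y`
  have hLm : 0 < F.L ^ m := pow_pos (F.P K).L_pos m
  have hn : 1 ≤ (F.P K).L ^ m := hLm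
  have h2n : 2 * (F.P K).L ^ m ≤ (F.P K).sitesPerDir 0 := by
    show 2 * F.L ^ m ≤ 2 * F.L ^ (F.m + K - 0)
    exact Nat.mul_le_mul_left _ (Nat.pow_le_pow_right (F.P K).L_pos (by omega))
  have hr' : r y ≤ (F.P K).L ^ m - 1 := by have := hr y; show r y ≤ F.L ^ m - 1; omega
  exact dist1_gaugeAct_le_of_root F K U hn h2n (fun μ => ((((y μ).val * (F.P K).L ^ m : ℕ)) : ZMod ((F.P K).sitesPerDir 0)))
    hr' (g y) (hga y) (fun p _ => hθ p) ℓ (fun k => box_of_iterBlockOf hk rfl k) (fun k => box_of_iterBlockOf hk hty k)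

/-- The same in the gauge-FIXED currency: `dist1((w⁻¹ • U) ℓ) ≤ 2(L^m − 1)·θ` on intra-block bonds (§0 bridge). [cite: Balaban1985RegularSpaces, (1.29) p.81] -/
theorem dist1_gaugeAct_inv_intra_le (K m : ℕ) (hm : m ≤ F.m + K) (U : GaugeField (F.P K) 0 G)
    (r : Site (F.P K) m → ℕ) (g : Site (F.P K) m → GaugeTransf (F.P K) 0 G) (w : Site (F.P K) 0 → G)
    (hr : ∀ y, r y < F.L ^ m)
    (hga : ∀ y (x : Fin (F.P K).d → ℤ), (fun k => (((((y k).val * (F.P K).L ^ m : ℕ) : ZMod ((F.P K).sitesPerDir 0))).val : ℤ)) ≤ x →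
        x ≤ (fun k => (((((y k).val * (F.P K).L ^ m : ℕ) : ZMod ((F.P K).sitesPerDir 0))).val : ℤ) + ((F.L ^ m - 1 : ℕ) : ℤ)) →
        g y (castSite x) = axialFn (pull U) ((fun k => (((((y k).val * (F.P K).L ^ m : ℕ) : ZMod ((F.P K).sitesPerDir 0))).val : ℤ)) + (r y : ℤ) • e 0) x)
    (hw : ∀ x, w x = (g (iterBlockOf m x) x)⁻¹ * g (iterBlockOf m x) (embIter m (iterBlockOf m x)))
    {θ : ℝ} (hθ : ∀ p : Plaq (F.P K) 0, dist1 (GaugeField.plaqHol U p) ≤ θ)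
    (ℓ : PBond (F.P K) 0) (hℓ : iterBlockOf m ℓ.src = iterBlockOf m ℓ.tgt) :
    dist1 (GaugeField.gaugeAct (fun x => (w x)⁻¹) U ℓ) ≤ 2 * ((F.L ^ m - 1 : ℕ) : ℝ) * θ := by
  rw [← dist1_mul_gaugeAct_one_inv]
  exact dist1_intra_le F K m hm U r g w hr hga hw hθ ℓ hℓ

/-! ## §3 Face neighbours: two parallel bonds of one plaquette whose connecting bonds are intra-block -/

/-- ★★ **FACE-NEIGHBOUR LETTER, `μ`-BONDS.**  In the glued gauge of (11), for a plaquette `p = ⟨x, μ, ν⟩` whose two `ν`-bonds are intra-block (so its two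
`μ`-bonds leave the same block through the same face, or are themselves intra-block), the gauge-fixed variables `X_ℓ := (w⁻¹ • U) ℓ` of the two `μ`-bonds satisfy
`dist1(X_{(x,μ)}·X_{(x+e_ν,μ)}⁻¹) ≤ θ + 2·(2(L^m−1)·θ)`: one plaquette plus two intra bonds (§0 + §2). [cite: Balaban1985RegularSpaces, (1.29) p.81] -/
theorem dist1_cross_mul_inv_cross_le_mu (K m : ℕ) (hm : m ≤ F.m + K) (U : GaugeField (F.P K) 0 G)
    (r : Site (F.P K) m → ℕ) (g : Site (F.P K) m → GaugeTransf (F.P K) 0 G) (w : Site (F.P K) 0 → G)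
    (hr : ∀ y, r y < F.L ^ m)
    (hga : ∀ y (x : Fin (F.P K).d → ℤ), (fun k => (((((y k).val * (F.P K).L ^ m : ℕ) : ZMod ((F.P K).sitesPerDir 0))).val : ℤ)) ≤ x →
        x ≤ (fun k => (((((y k).val * (F.P K).L ^ m : ℕ) : ZMod ((F.P K).sitesPerDir 0))).val : ℤ) + ((F.L ^ m - 1 : ℕ) : ℤ)) →
        g y (castSite x) = axialFn (pull U) ((fun k => (((((y k).val * (F.P K).L ^ m : ℕ) : ZMod ((F.P K).sitesPerDir 0))).val : ℤ)) + (r y : ℤ) • e 0) x)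
    (hw : ∀ x, w x = (g (iterBlockOf m x) x)⁻¹ * g (iterBlockOf m x) (embIter m (iterBlockOf m x)))
    {θ : ℝ} (hθ : ∀ p : Plaq (F.P K) 0, dist1 (GaugeField.plaqHol U p) ≤ θ)
    (p : Plaq (F.P K) 0)
    (hν₁ : iterBlockOf m (⟨p.src, p.ν⟩ : PBond (F.P K) 0).src = iterBlockOf m (⟨p.src, p.ν⟩ : PBond (F.P K) 0).tgt)
    (hν₂ : iterBlockOf m (⟨p.src.shift p.μ, p.ν⟩ : PBond (F.P K) 0).src = iterBlockOf m (⟨p.src.shift p.μ, p.ν⟩ : PBond (F.P K) 0).tgt) :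
    dist1 (GaugeField.gaugeAct (fun x => (w x)⁻¹) U ⟨p.src, p.μ⟩ * (GaugeField.gaugeAct (fun x => (w x)⁻¹) U ⟨p.src.shift p.ν, p.μ⟩)⁻¹) ≤
      θ + 2 * (2 * ((F.L ^ m - 1 : ℕ) : ℝ) * θ) := by
  have h := dist1_gaugeAct_mul_inv_le_of_plaq_mu (fun x => (w x)⁻¹) U p
  have h1 := dist1_gaugeAct_inv_intra_le F K m hm U r g w hr hga hw hθ ⟨p.src.shift p.μ, p.ν⟩ hν₂
  have h2 := dist1_gaugeAct_inv_intra_le F K m hm U r g w hr hga hw hθ ⟨p.src, p.ν⟩ hν₁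
  have h3 := hθ p
  linarith

/-- ★★ **FACE-NEIGHBOUR LETTER, `ν`-BONDS** (the mirror case: the two `μ`-bonds of `p` are intra-block):
`dist1(X_{(x,ν)}·X_{(x+e_μ,ν)}⁻¹) ≤ θ + 2·(2(L^m−1)·θ)`. [cite: Balaban1985RegularSpaces, (1.29) p.81] -/
theorem dist1_cross_mul_inv_cross_le_nu (K m : ℕ) (hm : m ≤ F.m + K) (U : GaugeField (F.P K) 0 G)
    (r : Site (F.P K) m → ℕ) (g : Site (F.P K) m → GaugeTransf (F.P K) 0 G) (w : Site (F.P K) 0 → G)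
    (hr : ∀ y, r y < F.L ^ m)
    (hga : ∀ y (x : Fin (F.P K).d → ℤ), (fun k => (((((y k).val * (F.P K).L ^ m : ℕ) : ZMod ((F.P K).sitesPerDir 0))).val : ℤ)) ≤ x →
        x ≤ (fun k => (((((y k).val * (F.P K).L ^ m : ℕ) : ZMod ((F.P K).sitesPerDir 0))).val : ℤ) + ((F.L ^ m - 1 : ℕ) : ℤ)) →
        g y (castSite x) = axialFn (pull U) ((fun k => (((((y k).val * (F.P K).L ^ m : ℕ) : ZMod ((F.P K).sitesPerDir 0))).val : ℤ)) + (r y : ℤ) • e 0) x)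
    (hw : ∀ x, w x = (g (iterBlockOf m x) x)⁻¹ * g (iterBlockOf m x) (embIter m (iterBlockOf m x)))
    {θ : ℝ} (hθ : ∀ p : Plaq (F.P K) 0, dist1 (GaugeField.plaqHol U p) ≤ θ)
    (p : Plaq (F.P K) 0)
    (hμ₁ : iterBlockOf m (⟨p.src, p.μ⟩ : PBond (F.P K) 0).src = iterBlockOf m (⟨p.src, p.μ⟩ : PBond (F.P K) 0).tgt)
    (hμ₂ : iterBlockOf m (⟨p.src.shift p.ν, p.μ⟩ : PBond (F.P K) 0).src = iterBlockOf m (⟨p.src.shift p.ν, p.μ⟩ : PBond (F.P K) 0).tgt) :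
    dist1 (GaugeField.gaugeAct (fun x => (w x)⁻¹) U ⟨p.src, p.ν⟩ * (GaugeField.gaugeAct (fun x => (w x)⁻¹) U ⟨p.src.shift p.μ, p.ν⟩)⁻¹) ≤
      θ + 2 * (2 * ((F.L ^ m - 1 : ℕ) : ℝ) * θ) := by
  have h := dist1_gaugeAct_mul_inv_le_of_plaq_nu (fun x => (w x)⁻¹) U p
  have h1 := dist1_gaugeAct_inv_intra_le F K m hm U r g w hr hga hw hθ ⟨p.src, p.μ⟩ hμ₁
  have h2 := dist1_gaugeAct_inv_intra_le F K m hm U r g w hr hga hw hθ ⟨p.src.shift p.ν, p.μ⟩ hμ₂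
  have h3 := hθ p
  linarith

end Glued

end Summit.QuantumFields.YangMills.Theorems.FluctuationComparisonRegPrIntLS2BetaBoxGaugeSupLetters
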